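import Summits.QuantumFields.BalabanUV.Beta.EriceRemainderEnclosureHistoryAutonomyComparisonAgeCompositionDecayBudgetWindow

/-!
# EriceRemainderEnclosureHistoryAutonomyComparisonAgeCompositionDecayBoundaryFlowFacts — (E85e, first part) route (N), first order: FLOW FACTS AND PURE
# BOOKKEEPING FOR THE FIRST SLOT MERGED WITH THE BOUNDARY of the (S-d) budget — relative steps and window ratios are monotone in depth, the deep slots'
# surpluses in units of the first slot's young coefficient are at least `(64∕3)(1∕√5 − 1∕√(k+4))`, the growth majorant's bound is a priori at most `5∕w`,
# and the two linear combinations that close the merged slot once the certificates of (E85b)∕(E85c) are supplied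

Cell `pub-balaban`, β-function sub-cell, BINDER row D4 «RemainderConst leaves for Bałaban's split» (`HOME/BINDER-OWNERS.md`; owner lineage `b2b-balaban-beta-an4`;
this file by co-owner #2 lineage `b2b-balaban-beta-d4-p2`, generation 76), β-FLOW TEAM duty (1), FREEZE (0) honoured (def-free; imports (E84d) `…DecayBudgetWindow`;
uses (E48a) `strictAnti_of_memFlow`, (E58b) `increment_anti` ∕ `mul_sqrt_le_read`, (E84d) `sum_rpow_ge_telescope` BY NAME; nothing restated).

HONEST FRAMING (page 1, verbatim and binding).  *"Discharging BetaPertH makes Bałaban's UV stability UNCONDITIONAL — a real constructive-QFT result; it is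
NOT the continuum limit and NOT the Clay problem."*  THIS FILE DISCHARGES NOTHING OF THE KIND.  Elementary real analysis about ABSTRACT functionals on a box
]0,γ]^ℕ with displayed floors, profiles and signs, and the FIRST-ORDER renewal objects of route (N) built from them — hypotheses of a census, not facts; the
form, signs, ages and moments of Bałaban's (1.22) limit functional are NOT PRINTED ([I] p. 298; GAPS G-t4-U2-1∕-2) and NOT asserted.  Row D4 class
UNCHANGED (critical-path width 0; instance 0∕1; D4 DISCHARGE NO DATE).  HONEST DEPENDENCY: continuum YM on T⁴ ⇐ BetaPertH ∧ nine spine estimates (0/9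
proved); BetaPertH ⇐ (D1) ∧ (D4) ∧ CAP+tail; G-an2-4 gates asym, D1 and NE2/3/4.

THE POINT (census sense (α); route (N); README `HOME/b2b-balaban-beta-d4-p2/g76/e85/README.md`).  Ingredients of the next file's `slot_first_merged`:
§1 `relStep_le_relStep` (`z_m ≤ z_n` for `n ≤ m`), **`fund_ge`** (`Σ_{q∈[m+3,m+2+k)} (4∕3)d_{q+1} ≥ d_{m+3}·(64∕3)(1∕√5 − 1∕√(k+4))`: each deep young coefficient is
within `(4∕(4+j))^{3∕2}` of `d_{m+3}` by (E58b) `mul_sqrt_le_read`, and the telescoping minorant (E84d) `sum_rpow_ge_telescope`), `de_bound` (the last factor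
`u ↦ u∕(1−u)` is monotone), **`hat_small`** (`w·Ĥ ≤ 5` from `w² ≤ 4∕3`, `R ≤ 1 + (k−1)(w²−1)`, `k(t²−1) ≤ σ ≤ 1 − 2∕(3R)`, `4x ≤ 3σ`: so `1 − (w∕6)Ĥ > 0`),
`combine_merged` ∕ `combine_merged_two` (the final linear combinations, `k ≥ 3` ∕ `k = 2`), **`windowRatio_mono`** (`a_n∕a_{n+k}` increases with `n`: the
old read of the old decay step sits within the slot's tangent factor).  NOT CLAIMED: anything printed.

WHAT IS PROVED ([folklore]; 0 `def`, 0 sorry).  §1 `relStep_le_relStep`, **`fund_ge`**, `de_bound`, **`hat_small`**, `combine_merged`, `combine_merged_two`,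
**`windowRatio_mono`**.
-/
noncomputable section
open Finset

namespace Summit.QuantumFields.BalabanUV.Beta.EriceRemainderEnclosureHistoryAutonomyComparisonAgeCompositionDecayBoundaryFlowFacts

open Literature.MathematicalPhysics.QuantumFieldTheory.Balaban1983to89
open Literature.MathematicalPhysics.QuantumFieldTheory.Balaban1983to89.T4BetaStationary
open Literature.MathematicalPhysics.QuantumFieldTheory.Balaban1983to89.T4BetaFlowWellPosed
open Summit.QuantumFields.BalabanUV.Beta.EriceRemainderEnclosureHistoryAutonomyOrder (strictAnti_of_memFlow)
open Summit.QuantumFields.BalabanUV.Beta.EriceRemainderEnclosureHistoryAutonomyComparisonAffineProfile (increment_anti mul_sqrt_le_read)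
open Summit.QuantumFields.BalabanUV.Beta.EriceRemainderEnclosureHistoryAutonomyComparisonAgeCompositionYoungestTailSumFlow (load_le_half_step
  step_le_of_window load_le_of_window)
open Summit.QuantumFields.BalabanUV.Beta.EriceRemainderEnclosureHistoryAutonomyComparisonAgeCompositionDecayBudgetSlots (step_ge_reads defect_up_le
  step_le_inv)
open Summit.QuantumFields.BalabanUV.Beta.EriceRemainderEnclosureHistoryAutonomyComparisonAgeCompositionDecayBudgetWindow (invSq_add_le_tangent
  sum_rpow_ge_telescope)

variable {B : (ℕ → ℝ) → ℝ} {γ b gIR : ℝ} {L : ℕ → ℝ} {K : ℕ} {h : ℕ → ℝ}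

/-! ## §1 Flow facts and pure bookkeeping for the merged slot -/

/-- Relative steps decrease along the flow: for `n ≤ m`, `(h_m∕h_{m+1})² − 1 ≤ (h_n∕h_{n+1})² − 1` (`Δ_m ≤ Δ_n`, `h_m ≤ h_n`). [folklore] -/
theorem relStep_le_relStep (hmono : ∀ u v : ℕ → ℝ, SeqBox γ u → SeqBox γ v → (∀ j, u j ≤ v j) → B u ≤ B v) (hb : 0 < b)
    (hlo : ∀ u, SeqBox γ u → b ≤ B u) (hh : SeqBox γ h) (hf : MemFlow B gIR h) {n m : ℕ} (hnm : n ≤ m) :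
    (h m / h (m + 1)) ^ 2 - 1 ≤ (h n / h (n + 1)) ^ 2 - 1 := by
  have hpos : ∀ n, 0 < h n := fun n => (hh n).1
  have hanti := (strictAnti_of_memFlow hb hlo hh hf).antitone
  have h0 := hpos n; have h1 := hpos (n + 1); have hm := hpos m; have hm1 := hpos (m + 1)
  have e0 := hf.2 n
  have em := hf.2 m
  have hinc := increment_anti hmono hb hlo hh hf hnm
  have hD0 : 0 ≤ 1 / h (n + 1) ^ 2 - 1 / h n ^ 2 := by
    have : h (n + 1) ^ 2 ≤ h n ^ 2 := pow_le_pow_left₀ h1.le (hanti (Nat.le_succ n)) 2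
    rw [sub_nonneg]; exact one_div_le_one_div_of_le (pow_pos h1 2) this
  have ez : (h m / h (m + 1)) ^ 2 - 1 = h m ^ 2 * (1 / h (m + 1) ^ 2 - 1 / h m ^ 2) := by rw [div_pow]; field_simp
  have ey : (h n / h (n + 1)) ^ 2 - 1 = h n ^ 2 * (1 / h (n + 1) ^ 2 - 1 / h n ^ 2) := by rw [div_pow]; field_simp
  rw [ez, ey]
  have hsq : h m ^ 2 ≤ h n ^ 2 := pow_le_pow_left₀ hm.le (hanti hnm) 2
  calc h m ^ 2 * (1 / h (m + 1) ^ 2 - 1 / h m ^ 2) ≤ h m ^ 2 * (1 / h (n + 1) ^ 2 - 1 / h n ^ 2) :=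
        mul_le_mul_of_nonneg_left (by linarith) (sq_nonneg _)
    _ ≤ h n ^ 2 * (1 / h (n + 1) ^ 2 - 1 / h n ^ 2) := mul_le_mul_of_nonneg_right hsq hD0

/-- **THE DEEP SURPLUSES IN UNITS OF THE FIRST SLOT'S YOUNG COEFFICIENT**: along a box solution of an isotone memory with floor, for `k ≥ 1`,
`Σ_{q∈[m+3,m+2+k)} (4∕3)·L_1h_{q+2}³∕2 ≥ (L_1h_{m+4}³∕2)·(64∕3)(1∕√5 − 1∕√(k+4))` — each `h_{m+5+i} ≥ √((m+4)∕(m+5+i))·h_{m+4} ≥ (2∕√(5+i))·h_{m+4}`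
((E58b) `mul_sqrt_le_read`) and `Σ_{i<k−1} (5+i)^{−3∕2} ≥ 2(1∕√5 − 1∕√(k+4))` ((E84d) `sum_rpow_ge_telescope`). [folklore] -/
theorem fund_ge (hmono : ∀ u v : ℕ → ℝ, SeqBox γ u → SeqBox γ v → (∀ j, u j ≤ v j) → B u ≤ B v) (hL : ∀ k, 0 ≤ L k) (hb : 0 < b)
    (hlo : ∀ u, SeqBox γ u → b ≤ B u) (hh : SeqBox γ h) (hf : MemFlow B gIR h) {k : ℕ} (hk1 : 1 ≤ k) (m : ℕ) :
    (L 1 * h (m + 4) ^ 3 / 2) * (64 / 3 * (1 / Real.sqrt 5 - 1 / Real.sqrt (k + 4)))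
      ≤ ∑ q ∈ Ico (m + 3) (m + 2 + k), 4 / 3 * (L 1 * h (q + 2) ^ 3 / 2) := by
  have hpos : ∀ n, 0 < h n := fun n => (hh n).1
  have hgIR : 0 < gIR := by rw [← hf.1]; exact hpos 0
  have hd0 : 0 ≤ L 1 * h (m + 4) ^ 3 / 2 := by have := hL 1; have := hpos (m + 4); positivity
  rw [sum_Ico_eq_sum_range, show m + 2 + k - (m + 3) = k - 1 by omega]
  -- termwise
  have hterm : ∀ i ∈ range (k - 1), (L 1 * h (m + 4) ^ 3 / 2) * (32 / 3 * (1 / ((5 + (i : ℝ)) * Real.sqrt (5 + (i : ℝ)))))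
      ≤ 4 / 3 * (L 1 * h (m + 3 + i + 2) ^ 3 / 2) := by
    intro i _
    have hr := mul_sqrt_le_read hmono hb hlo hgIR hh hf (m + 4) (i + 1)
    rw [show m + 4 + (i + 1) = m + 3 + i + 2 by ring] at hr
    have hs0 : 0 < (5 : ℝ) + i := by positivity
    have hsq : 0 < Real.sqrt (5 + (i : ℝ)) := Real.sqrt_pos.2 hs0
    -- the ratio is at least `4/(5+i)`
    have hratio : 4 / (5 + (i : ℝ)) ≤ ((m + 4 : ℕ) : ℝ) / (((m + 4 : ℕ) : ℝ) + ((i + 1 : ℕ) : ℝ)) := by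
      push_cast
      rw [div_le_div_iff₀ hs0 (by positivity)]
      have : (0 : ℝ) ≤ m := Nat.cast_nonneg m
      nlinarith
    have hsqrt : 2 / Real.sqrt (5 + (i : ℝ)) ≤ Real.sqrt (((m + 4 : ℕ) : ℝ) / (((m + 4 : ℕ) : ℝ) + ((i + 1 : ℕ) : ℝ))) := by
      have e : 2 / Real.sqrt (5 + (i : ℝ)) = Real.sqrt (4 / (5 + (i : ℝ))) := by
        rw [Real.sqrt_div' _ hs0.le, show (4 : ℝ) = 2 ^ 2 by norm_num, Real.sqrt_sq (by norm_num)]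
      rw [e]; exact Real.sqrt_le_sqrt hratio
    have h4 := hpos (m + 4)
    have hread : 2 / Real.sqrt (5 + (i : ℝ)) * h (m + 4) ≤ h (m + 3 + i + 2) :=
      (mul_le_mul_of_nonneg_right hsqrt h4.le).trans hr
    have hl0 : 0 ≤ 2 / Real.sqrt (5 + (i : ℝ)) * h (m + 4) := by positivity
    have hcube := pow_le_pow_left₀ hl0 hread 3
    have e3 : (2 / Real.sqrt (5 + (i : ℝ)) * h (m + 4)) ^ 3 = 8 * (1 / ((5 + (i : ℝ)) * Real.sqrt (5 + (i : ℝ)))) * h (m + 4) ^ 3 := by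
      rw [mul_pow, div_pow, show Real.sqrt (5 + (i : ℝ)) ^ 3 = (5 + (i : ℝ)) * Real.sqrt (5 + (i : ℝ)) by
        rw [pow_succ, Real.sq_sqrt hs0.le]]
      ring
    rw [e3] at hcube
    have hL1 := hL 1
    have := mul_le_mul_of_nonneg_left hcube (by positivity : (0 : ℝ) ≤ 4 / 3 * (L 1 / 2))
    have e4 : 4 / 3 * (L 1 / 2) * (8 * (1 / ((5 + (i : ℝ)) * Real.sqrt (5 + (i : ℝ)))) * h (m + 4) ^ 3)
        = (L 1 * h (m + 4) ^ 3 / 2) * (32 / 3 * (1 / ((5 + (i : ℝ)) * Real.sqrt (5 + (i : ℝ))))) := by ring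
    have e5 : 4 / 3 * (L 1 / 2) * h (m + 3 + i + 2) ^ 3 = 4 / 3 * (L 1 * h (m + 3 + i + 2) ^ 3 / 2) := by ring
    rw [e4, e5] at this
    exact this
  have hsum := sum_le_sum hterm
  rw [← mul_sum, ← mul_sum] at hsum
  refine le_trans ?_ hsum
  refine mul_le_mul_of_nonneg_left ?_ hd0
  have htel := sum_rpow_ge_telescope (by norm_num : (0:ℝ) < 5) (k - 1)
  rw [Nat.cast_sub hk1, Nat.cast_one, show (5 : ℝ) + ((k : ℝ) - 1) = k + 4 by ring] at htel
  linarith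

/-- The last factor is monotone: `dH∕(1−dH) ≤ dĤ∕(1−δ)` for `0 ≤ d`, `0 ≤ H ≤ Ĥ`, `dĤ ≤ δ < 1`. [folklore] -/
theorem de_bound {d H Hh δ : ℝ} (hd0 : 0 ≤ d) (hH0 : 0 ≤ H) (hHh : H ≤ Hh) (hδ : d * Hh ≤ δ) (hδ1 : δ < 1) :
    d * H / (1 - d * H) ≤ d * Hh / (1 - δ) := by
  have h1 : d * H ≤ d * Hh := mul_le_mul_of_nonneg_left hHh hd0
  exact div_le_div₀ (by nlinarith) h1 (by linarith) (by linarith)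

/-- An a-priori bound of the growth majorant's bound: under `w² ≤ 4∕3`, `1 ≤ R ≤ 1 + (k−1)(w²−1)`, `k ≥ 2`, `1 ≤ t`, `k(t²−1) ≤ σ ≤ 1 − 2∕(3R)`,
`0 ≤ x ≤ 3σ∕4`:  `w·Ĥ ≤ 5`, `Ĥ = (1 + (t²−1)(3∕(2t²)+1∕2)·x∕(1−x))∕(1 − x∕k)` (so the last factor's amplification `1∕(1 − (w∕6)Ĥ)` is finite). [folklore] -/
theorem hat_small {w R k t σ x : ℝ} (hk : 2 ≤ k) (hw1 : 1 ≤ w) (hwy : w ^ 2 ≤ 4 / 3) (hR1 : 1 ≤ R) (hRk : R ≤ 1 + (k - 1) * (w ^ 2 - 1))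
    (ht1 : 1 ≤ t) (hkt : k * (t ^ 2 - 1) ≤ σ) (hσR : σ ≤ 1 - 2 / (3 * R)) (hx0 : 0 ≤ x) (hxa : 4 * x ≤ 3 * σ) :
    w * ((1 + (t ^ 2 - 1) * (3 / (2 * t ^ 2) + 1 / 2) * (x / (1 - x))) / (1 - x / k)) ≤ 5 := by
  have hk0 : 0 < k := by linarith
  have hRk3 : R ≤ (k + 2) / 3 := by nlinarith
  have hσ : σ ≤ k / (k + 2) := by
    have hRpos : 0 < R := by linarith
    have : 2 / (k + 2) ≤ 2 / (3 * R) := div_le_div_of_nonneg_left (by norm_num) (by positivity) (by linarith)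
    have e : (k : ℝ) / (k + 2) = 1 - 2 / (k + 2) := by field_simp; ring
    linarith
  have hσ1 : σ < 1 := lt_of_le_of_lt hσ (by rw [div_lt_one (by linarith)]; linarith)
  have hx34 : x ≤ 3 / 4 := by linarith
  have hx1 : 0 < 1 - x := by linarith
  have ht21 : 0 ≤ t ^ 2 - 1 := by nlinarith
  -- `t² − 1 ≤ σ/k ≤ 1/(k+2) ≤ 1/4`
  have hE : t ^ 2 - 1 ≤ 1 / 4 := by
    have h1 : k * (t ^ 2 - 1) ≤ k / (k + 2) := hkt.trans hσ
    have h2 : (k : ℝ) / (k + 2) ≤ k * (1 / 4) := by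
      rw [div_le_iff₀ (by linarith)]; nlinarith
    nlinarith
  have hEH : (t ^ 2 - 1) * (3 / (2 * t ^ 2) + 1 / 2) ≤ 1 / 2 := by
    have ht2 : 1 ≤ t ^ 2 := by nlinarith
    have : 3 / (2 * t ^ 2) ≤ 3 / 2 := div_le_div_of_nonneg_left (by norm_num) (by norm_num) (by linarith)
    nlinarith
  have hω : x / (1 - x) ≤ 3 := by rw [div_le_iff₀ hx1]; linarith
  have hnum : 1 + (t ^ 2 - 1) * (3 / (2 * t ^ 2) + 1 / 2) * (x / (1 - x)) ≤ 5 / 2 := by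
    have := mul_le_mul hEH hω (div_nonneg hx0 hx1.le) (by norm_num); linarith
  have hden : 5 / 8 ≤ 1 - x / k := by
    have : x / k ≤ 3 / 4 / 2 := by
      calc x / k ≤ x / 2 := div_le_div_of_nonneg_left hx0 (by norm_num) hk
        _ ≤ 3 / 4 / 2 := by linarith
    linarith
  have hH : (1 + (t ^ 2 - 1) * (3 / (2 * t ^ 2) + 1 / 2) * (x / (1 - x))) / (1 - x / k) ≤ 4 := by
    rw [div_le_iff₀ (by linarith)]; linarith
  have hw : w ≤ 5 / 4 := by nlinarith
  have hH0 : 0 ≤ (1 + (t ^ 2 - 1) * (3 / (2 * t ^ 2) + 1 / 2) * (x / (1 - x))) / (1 - x / k) :=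
    div_nonneg (by have := mul_nonneg (mul_nonneg ht21 (by positivity : (0:ℝ) ≤ 3 / (2 * t ^ 2) + 1 / 2)) (div_nonneg hx0 hx1.le); linarith)
      (by linarith)
  calc w * _ ≤ 5 / 4 * 4 := mul_le_mul hw hH hH0 (by norm_num)
    _ = 5 := by norm_num

/-- Bookkeeping of the merged first slot for `k ≥ 3` (pure linear combination). [folklore] -/
theorem combine_merged {c1 d1 t l w v g x Y Yb k q' R Fnd FUND D DE : ℝ} (hc1 : 0 ≤ c1) (hd1 : 0 ≤ d1)
    (hMO : 0 ≤ 3 * R * t ^ 2 + 3 * l ^ 2 * q' * t ^ 2 - l ^ 3 * t ^ 3 - t ^ 3 / (1 - x / k) - k * (t ^ 2 - 1) * (3 * t + t ^ 3) / (2 * (1 - x)) - t ^ 3)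
    (hMY : 0 ≤ 3 * w ^ 2 + 3 * g ^ 3 + Fnd - v ^ 3 * w ^ 3 - w ^ 3 - w ^ 3 * D)
    (hcredit : 2 * d1 * w ^ 2 + 2 * c1 * R * t ^ 2 ≤ Y) (hAb : 2 * d1 * g ^ 3 + 2 * c1 * ((l * t) ^ 2 * q') ≤ Yb)
    (hFund : d1 * Fnd ≤ FUND) (hDE : DE ≤ d1 * (w ^ 3 * D)) :
    d1 * (v * w) ^ 3 + c1 * (l * t) ^ 3 + c1 * (t ^ 3 / (1 - x / k)) + c1 * (k * (t ^ 2 - 1) * (3 * t + t ^ 3) / (2 * (1 - x)))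
      + (d1 * w ^ 3 + c1 * t ^ 3) + DE ≤ 3 / 2 * (Y + Y ^ 2 / 2) + 3 / 2 * (Yb + Yb ^ 2 / 2) + FUND := by
  have h1 := mul_nonneg hc1 hMO
  have h2 := mul_nonneg hd1 hMY
  nlinarith [sq_nonneg Y, sq_nonneg Yb]

/-- Bookkeeping of the merged first slot for `k = 2` (pure linear combination). [folklore] -/
theorem combine_merged_two {c1 d1 t w v x Y k FUND D DE : ℝ} (hk : k = 2) (hc1 : 0 ≤ c1) (hd1 : 0 ≤ d1)
    (hMO : 0 ≤ 6 * w ^ 2 * t ^ 2 - w ^ 3 * t ^ 3 - t ^ 3 / (1 - x / 2) - 2 * (t ^ 2 - 1) * (3 * t + t ^ 3) / (2 * (1 - x)) - t ^ 3)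
    (hMY : 0 ≤ 6 * w ^ 2 + 4 / 3 / t ^ 3 - v ^ 3 * w ^ 3 - w ^ 3 - w ^ 3 * D)
    (hcredit : 2 * d1 * w ^ 2 + 2 * c1 * w ^ 2 * t ^ 2 ≤ Y) (hFund : d1 * (4 / 3 / t ^ 3) ≤ FUND) (hDE : DE ≤ d1 * (w ^ 3 * D)) :
    d1 * (v * w) ^ 3 + c1 * (w * t) ^ 3 + c1 * (t ^ 3 / (1 - x / k)) + c1 * (k * (t ^ 2 - 1) * (3 * t + t ^ 3) / (2 * (1 - x)))
      + (d1 * w ^ 3 + c1 * t ^ 3) + DE ≤ 3 / 2 * (Y + Y ^ 2 / 2) + 3 / 2 * (Y + Y ^ 2 / 2) + FUND := by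
  subst hk
  have h1 := mul_nonneg hc1 hMO
  have h2 := mul_nonneg hd1 hMY
  nlinarith [sq_nonneg Y]


/-- Window ratios increase with depth: `(h_{n+k}∕h_n)² ≤ (h_{n+1+k}∕h_{n+1})²`, i.e. `a_n∕a_{n+k} ≤ a_{n+1}∕a_{n+1+k}` (`Δ_{n+k} ≤ Δ_n`, `a_n ≤ a_{n+k}`). [folklore] -/
theorem windowRatio_mono (hmono : ∀ u v : ℕ → ℝ, SeqBox γ u → SeqBox γ v → (∀ j, u j ≤ v j) → B u ≤ B v) (hb : 0 < b)
    (hlo : ∀ u, SeqBox γ u → b ≤ B u) (hh : SeqBox γ h) (hf : MemFlow B gIR h) (n k : ℕ) :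
    (h (n + k) / h n) ^ 2 ≤ (h (n + 1 + k) / h (n + 1)) ^ 2 := by
  have hpos : ∀ n, 0 < h n := fun n => (hh n).1
  have hanti := (strictAnti_of_memFlow hb hlo hh hf).antitone
  have h0 := hpos n; have h1 := hpos (n + 1); have hk := hpos (n + k); have hk1 := hpos (n + 1 + k)
  have e0 := hf.2 n
  have ek := hf.2 (n + k)
  rw [show n + k + 1 = n + 1 + k by ring] at ek
  have hinc := increment_anti hmono hb hlo hh hf (show n ≤ n + k by omega)
  rw [show n + k + 1 = n + 1 + k by ring] at hinc
  -- a_n Δ_{n+k} ≤ Δ_n a_{n+k}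
  have hD0 : 0 ≤ 1 / h (n + 1) ^ 2 - 1 / h n ^ 2 := by
    have : h (n + 1) ^ 2 ≤ h n ^ 2 := pow_le_pow_left₀ h1.le (hanti (Nat.le_succ n)) 2
    rw [sub_nonneg]; exact one_div_le_one_div_of_le (pow_pos h1 2) this
  have hak : 1 / h n ^ 2 ≤ 1 / h (n + k) ^ 2 := one_div_le_one_div_of_le (pow_pos hk 2) (pow_le_pow_left₀ hk.le (hanti (by omega)) 2)
  have key : (1 / h n ^ 2) * (1 / h (n + 1 + k) ^ 2) ≤ (1 / h (n + 1) ^ 2) * (1 / h (n + k) ^ 2) := by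
    have eq1 : 1 / h (n + 1 + k) ^ 2 = 1 / h (n + k) ^ 2 + B (fun j => h (n + 1 + k + j)) := ek
    have eq0 : 1 / h (n + 1) ^ 2 = 1 / h n ^ 2 + B (fun j => h (n + 1 + j)) := e0
    rw [eq1, eq0]
    have hBk : B (fun j => h (n + 1 + k + j)) ≤ B (fun j => h (n + 1 + j)) := hinc
    have hBk0 : 0 ≤ B (fun j => h (n + 1 + k + j)) := le_trans hb.le (hlo _ (seqBox_shift hh (n + 1 + k)))
    have hprod := mul_le_mul hak hBk hBk0 (by positivity)
    nlinarith [hprod]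
  rw [div_pow, div_pow, div_le_div_iff₀ (pow_pos h0 2) (pow_pos h1 2)]
  have := mul_le_mul_of_nonneg_left key (by positivity : (0:ℝ) ≤ h n ^ 2 * h (n + 1) ^ 2 * h (n + k) ^ 2 * h (n + 1 + k) ^ 2)
  have e1 : h n ^ 2 * h (n + 1) ^ 2 * h (n + k) ^ 2 * h (n + 1 + k) ^ 2 * (1 / h n ^ 2 * (1 / h (n + 1 + k) ^ 2)) = h (n + k) ^ 2 * h (n + 1) ^ 2 := by
    field_simp
  have e2 : h n ^ 2 * h (n + 1) ^ 2 * h (n + k) ^ 2 * h (n + 1 + k) ^ 2 * (1 / h (n + 1) ^ 2 * (1 / h (n + k) ^ 2)) = h (n + 1 + k) ^ 2 * h n ^ 2 := by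
    field_simp
  rw [e1, e2] at this
  exact this

end Summit.QuantumFields.BalabanUV.Beta.EriceRemainderEnclosureHistoryAutonomyComparisonAgeCompositionDecayBoundaryFlowFacts

end
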